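import Summits.NavierStokesRegularity.FluidComputer.AnisotropyFace
import Literature.Analysis.FluidPDE.GradientRegularityCriteriaProofs
import Literature.Analysis.FluidPDE.NSSerrinRegularity
import HarnessLib

/-!
# Fluid computer — the level dictionary, GRADIENT SERRIN FACE (L47): the velocity gradient leaves every class
# `L^q_t L^r_x`, `2/q + 3/r = 2` (Beirão da Veiga)

HONEST FRAMING (cell `pub-fluidc`, verbatim): *low prior, high value-of-information experiment on Tao's
machine paradigm; NOT a claim that NS blows up.* Theorem side of the cell; nothing here is evidence of blow-up.
L30 (Serrin face) is stated on `u`, L30‴ adds the one gradient row `∫Z² dt = ∫‖∇u‖₂⁴ dt = ∞`, L31 the endpoint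
`∫‖ω‖_∞ dt = ∞`. Beirão da Veiga's criterion (1995; Lemarié-Rieusset 2016 §11 / Robinson–Rodrigo–Sadowski Thm.
12.3) — `∇u ∈ L^q(0,T;L^r)`, `2/q + 3/r = 2`, `1 < q < ∞` ⇒ regular — is PROVED in the tree on Tao's `H¹` patches
(`limsup_eH1NormSq_lt_top_of_gradient`) with Leray's `H¹` continuation; its rapid-decay binder is unused. Read on
the class through `AnisotropyFace.not_isH1RegularOn_Ioc`, for every maximal smooth solution `(u, p)` of the
unforced Navier–Stokes system on `ℝ³ × [0, T)` (`ν > 0`) which is Leray–Hopf from `u 0`: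

* `not_memLqLp_gradient(_window)` (**L47 — THE GRADIENT LEAVES EVERY SERRIN CLASS**): for all `1 < q < ∞`,
  `2/q + 3/r = 2` and every `t₀ ∈ [0, T)`: `∇u ∉ L^q(t₀, T; L^r(ℝ³))`, i.e. `∫_{t₀}^{T} ‖∇u(t)‖_{L^r}^q dt = ∞`
  (`r = 2`: L30‴; `r = 3`: `∫‖∇u‖_{L³}² = ∞`; `r → ∞`: towards BKM);
* `gradient_serrin_face`: assembled.

Reading for the machine paradigm (words): the whole Beirão da Veiga ladder of gradient rows diverges on every
terminal window — in the mean `‖∇u(t)‖_{L^r} ≳ (T − t)^{−(2r−3)/(2r)}`; a run whose gradient norms stay integrable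
at these exponents is not approaching a singularity. Class statements; no constants. Necessity only. 0 sorry; no
new definitions, no named facts.

## References

* H. Beirão da Veiga, Chinese Ann. Math. Ser. B 16 (1995) 407–412. [BeiraoDaVeiga1995]
* P. G. Lemarié-Rieusset, *The Navier–Stokes Problem in the 21st Century*, CRC 2016, §11.5. [LemarieRieusset2016]
* J. C. Robinson, J. L. Rodrigo, W. Sadowski, CUP 2016, Thm. 12.3, Lemma 8.16. [RobinsonRodrigoSadowski2016]
-/

noncomputable section

open MeasureTheory Set Function Filter Topology Metric
open scoped ENNReal NNReal
open Literature.Analysis.FluidPDE Literature.Analysis.FunctionSpaces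
open Summit.NavierStokesRegularity.FluidComputer.AnisotropyFace

namespace Summit.NavierStokesRegularity.FluidComputer.GradientSerrinFace

/-- **L47 — `∇u ∉ L^q(0, T; L^r)`, `2/q + 3/r = 2`, `1 < q < ∞`** (Beirão da Veiga 1995, PROVED in the tree on
Tao's `H¹` patches as `limsup_eH1NormSq_lt_top_of_gradient`; Leray's continuation `leray_continuation_H1_holds`
would then make `u` `H¹`-regular on `(0, T]`, against `not_isH1RegularOn_Ioc`).
[cite: BeiraoDaVeiga1995, Thm 1] [cite: RobinsonRodrigoSadowski2016, Thm. 12.3 with Lemma 8.16] -/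
theorem not_memLqLp_gradient {ν T : ℝ} (hν : 0 < ν) (hT : 0 < T)
    {u : ℝ → EuclideanSpace ℝ (Fin 3) → EuclideanSpace ℝ (Fin 3)} {p : ℝ → EuclideanSpace ℝ (Fin 3) → ℝ}
    (hmax : IsMaximalSmoothSolution ν 0 u p T) (hLH : IsLerayHopfOn T ν 0 (u 0) u)
    {q r : ℝ≥0∞} (h1q : 1 < q) (hqtop : q < ⊤) (hqr : 2 / q + 3 / r = 2) :
    ¬ MemLqLp q r (fun t x => fderiv ℝ (u t) x) (Ioo 0 T) := by
  intro hS
  obtain ⟨c, hc, hL2⟩ := tao2011_H1_local_almost_regular_holds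
  obtain ⟨hrtop, hr, -⟩ := bdv_exponents h1q hqtop hqr
  obtain ⟨hA, hLr⟩ := lintegral_ofReal_rpow_gradient_lt_top h1q hqtop hqr hS
  exact not_isH1RegularOn_Ioc hν hT hmax hLH
    (leray_continuation_H1_holds ν T hν hT (u 0) u hLH fun α β hα hαβ hβ hregI =>
      limsup_eH1NormSq_lt_top_of_gradient hL2 hc hν hLH hmax.1 hr hrtop hLr hA.ne hα hαβ hβ hregI)

/-- **L47 ON EVERY TERMINAL WINDOW**: for every `t₀ ∈ [0, T)`, `∇u ∉ L^q(t₀, T; L^r)` (restart at an a.e.-good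
time, `MemLqLp.translate`). [cite: BeiraoDaVeiga1995, Thm 1] [cite: RobinsonRodrigoSadowski2016, Thm. 12.3] -/
theorem not_memLqLp_gradient_window {ν T : ℝ} (hν : 0 < ν)
    {u : ℝ → EuclideanSpace ℝ (Fin 3) → EuclideanSpace ℝ (Fin 3)} {p : ℝ → EuclideanSpace ℝ (Fin 3) → ℝ}
    (hmax : IsMaximalSmoothSolution ν 0 u p T) (hLH : IsLerayHopfOn T ν 0 (u 0) u)
    {q r : ℝ≥0∞} (h1q : 1 < q) (hqtop : q < ⊤) (hqr : 2 / q + 3 / r = 2)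
    {t₀ : ℝ} (ht₀ : t₀ ∈ Ico 0 T) :
    ¬ MemLqLp q r (fun t x => fderiv ℝ (u t) x) (Ioo t₀ T) := by
  intro hS
  obtain ⟨s, hs, hLHs⟩ := hLH.exists_isLerayHopfOn_restart_Ioo hν.le ht₀.1 ht₀.2 le_rfl
  have hs0 : 0 < s := ht₀.1.trans_lt hs.1
  have hTs : 0 < T - s := sub_pos.2 hs.2
  have hmax' : IsMaximalSmoothSolution ν 0 (fun t => u (t + s)) (fun t => p (t + s)) (T - s) :=
    hmax.translate_zero hs0 hs.2
  have hLH' : IsLerayHopfOn (T - s) ν 0 ((fun t => u (t + s)) 0) (fun t => u (t + s)) := by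
    show IsLerayHopfOn (T - s) ν 0 (u (0 + s)) (fun t => u (t + s))
    rw [zero_add]
    exact hLHs
  have hS' : MemLqLp q r (fun t x => fderiv ℝ (u (t + s)) x) (Ioo 0 (T - s)) := by
    have h := hS.mono_set (Ioo_subset_Ioo hs.1.le le_rfl)
    rw [show Ioo s T = Ioo (0 + s) (T - s + s) by rw [zero_add, sub_add_cancel]] at h
    exact h.translate s
  exact not_memLqLp_gradient hν hTs hmax' hLH' h1q hqtop hqr hS'

/-- **THE GRADIENT SERRIN FACE, ASSEMBLED**: on every terminal window `∇u` lies in no class `L^q_tL^r_x` with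
`2/q + 3/r = 2`, `1 < q < ∞`. [cite: BeiraoDaVeiga1995, Thm 1] -/
theorem gradient_serrin_face {ν T : ℝ} (hν : 0 < ν)
    {u : ℝ → EuclideanSpace ℝ (Fin 3) → EuclideanSpace ℝ (Fin 3)} {p : ℝ → EuclideanSpace ℝ (Fin 3) → ℝ}
    (hmax : IsMaximalSmoothSolution ν 0 u p T) (hLH : IsLerayHopfOn T ν 0 (u 0) u) :
    ∀ (q r : ℝ≥0∞), 1 < q → q < ⊤ → 2 / q + 3 / r = 2 → ∀ t₀ ∈ Ico 0 T,
      ¬ MemLqLp q r (fun t x => fderiv ℝ (u t) x) (Ioo t₀ T) :=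
  fun _ _ h1q hqtop hqr _ ht₀ => not_memLqLp_gradient_window hν hmax hLH h1q hqtop hqr ht₀

end Summit.NavierStokesRegularity.FluidComputer.GradientSerrinFace

end
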